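import Literature.Algebra.Homology.OrderedCechPairSystemShuffle
import Literature.Algebra.Homology.OrderedCechSystemBicomplex
import HarnessLib

/-!
# The Alexander–Whitney cross product of a PURE TENSOR reads `f(front word) ⊗ g(back word)`
# (Eilenberg–Mac Lane 1953 §5; The Stacks Project, Tag 0BEC)

Layer `Literature/Algebra/Homology` (pure algebra; THEOREMS only: no definition, no instance, no notation, no named fact, no
`sorry`).  Cell `hodgecm-mathlib` FLOOR 0, P1 sub-line F-11, packet (iv)∕J3 (Künneth on the product cover), bridge letter
(B-ii) «cross = `p₁♯ ∪ p₂♯`», algebraic half = F0P1b-p04 (g0)'s HANDOFF «OPEN» item «the AW cross on `prodSystem` READS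
`f.altEvalAt(frontWord) ⊗ g.altEvalAt(backWord)`» (second hand F0P1a-p02 (g3) under B-p06 (g15), (R115)).  HC_CM is proved only
modulo the 7 printed citations until rung 0 closes — nothing here bears on a summit statement.

For two systems of `A`-modules `M` on `ι`, `N` on `κ` (finite linearly ordered index sets), ★ `OrderedCechSystemBicomplex`
identifies `Čᵃ(M) ⊗_A Čᵇ(N)` with the bidegree-`(a, b)` term `Čᵃᵇ(M ⊠ N) = Π_τ Π_σ M σ ⊗ N τ` of the ordered Čech bicomplex of
the product pair-system (`tensorCochainEquiv`, on pure tensors `f ⊗ g ↦ ((τ, σ) ↦ f σ ⊗ g τ)`), and ★ D16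
`OrderedCechPairSystemShuffle` defines the `(a, b)`-component of the CROSS PRODUCT (Alexander–Whitney map)
`crossComponent P a b n : Čᵃᵇ(P) → Čⁿ(lexSystem P)`, whose value at a chain `T = {w₀ < ⋯ < w_n}` of `ι ×ₗ κ` (`n = a + b`) is the
DOUBLE ALTERNATING EVALUATION `crossRead` of the bidegree cochain at the `π₁`-word of the front `a`-face and the `π₂`-word of the
back `b`-face (`frontWord`, `backWord`; ★ core-1 `SysCochain.altEvalAt`: signed, `0` on a repeated letter).  THIS FILE reads that
value on a pure tensor:

* `ext0At_tmul_const`, **`altEvalAt_tmul_const`** — in the `ι`-direction, for a fixed `y ∈ N t`, the cochain `σ ↦ f σ ⊗ y` of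
  the `ι`-system `(M ⊠ N)(·, t)` evaluates to `f.altEvalAt α s ⊗ y`;
* **`altEvalAt_tensorCochainEquiv_tmul`** — in the `κ`-direction, `E(f ⊗ g)` evaluates at a `κ`-word `β` to `σ ↦ f σ ⊗ g.altEvalAt β t`;
* **`crossRead_tensorCochainEquiv_tmul`** — `E(f ⊗ g)` read at `(α, β)` is `f.altEvalAt α s ⊗ g.altEvalAt β t`;
* **`crossValue_tensorCochainEquiv_tmul`**, **`crossComponent_tensorCochainEquiv_tmul`** — THE READ-OUT: in range `a + b = n`,
  `(× E(f ⊗ g))_T = f.altEvalAt (frontWord T) (π₁ T) ⊗ g.altEvalAt (backWord T) (π₂ T)` in `M (π₁ T) ⊗ N (π₂ T) = (lexSystem (M ⊠ N)) T`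
  ([EilenbergMacLane1953] §5: `(f × g)(w₀, …, w_n) = f(π₁ w₀, …, π₁ w_a) ⊗ g(π₂ w_a, …, π₂ w_n)`).

The scheme-side half of (B-ii) (B-p06 (g15)'s (B-i)∕(B-i′) identification `Č(lexSystem (𝒪 ⊠ 𝒪)) ≅ Č(W₀, 𝒪_{X×Y})`,
`a ⊗ b ↦ p♯a| · q♯b|`, against ★ `cupCochain` of the two ★ `refineCochain` pull-backs) is NOT here.

## References
* S. Eilenberg, S. Mac Lane, *On the groups `H(Π,n)`, I*, Ann. of Math. 58 (1953), §5 (the map `f × g`). [EilenbergMacLane1953]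
* The Stacks Project, Tag 0BEC (Künneth formula for Čech cohomology), Tag 01FG (alternating cochains). [StacksProject]
-/

universe u

open CategoryTheory MonoidalCategory TensorProduct

set_option backward.isDefEq.respectTransparency false -- `ModuleCat`-valued functors (as in ★ `OrderedCechSystemBicomplex`)

noncomputable section

namespace Literature.Algebra.Homology

namespace OrderedCech

variable {A : Type u} [CommRing A] {ι κ : Type} [LinearOrder ι] [LinearOrder κ]
  (M : Finset ι ⥤ ModuleCat.{u} A) (N : Finset κ ⥤ ModuleCat.{u} A)

/-! ## §1 The `ι`-direction: cochains `σ ↦ f σ ⊗ y` of the `ι`-system `(M ⊠ N)(·, t)` -/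

variable {M N} in
omit [LinearOrder κ] in
/-- Zero-extension of the cochain `σ ↦ f σ ⊗ y` of the `ι`-system `(M ⊠ N)(·, t)` (`y ∈ N t` fixed): `f.ext0At s' s ⊗ y`.
[cite: StacksProject, Tag 0BEC] -/
theorem ext0At_tmul_const {a : ℤ} (f : SysCochain M a) {t : Finset κ} (y : N.obj t) (s' s : Finset ι) :
    SysCochain.ext0At (M := (prodSystem M N).flip.obj t) (n := a) (fun σ => f σ ⊗ₜ[A] y) s' s = f.ext0At s' s ⊗ₜ[A] y := by
  unfold SysCochain.ext0At
  split_ifs with h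
  · change (M.map (homOfLE h.2) ▷ N.obj t) (f ⟨s', h.1⟩ ⊗ₜ y) = _
    rfl
  · rw [zero_tmul]

variable {M N} in
omit [LinearOrder κ] in
/-- **`ι`-direction**: the signed evaluation of `σ ↦ f σ ⊗ y` at an `ι`-word `α` is `f.altEvalAt α s ⊗ y` (the sign moves onto
the first factor; a repeated letter gives `0 ⊗ y = 0`). [cite: StacksProject, Tag 01FG] [cite: EilenbergMacLane1953, §5] -/
theorem altEvalAt_tmul_const {a : ℤ} (f : SysCochain M a) {t : Finset κ} (y : N.obj t) {p : ℕ} (α : Fin p → ι)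
    (s : Finset ι) :
    SysCochain.altEvalAt (M := (prodSystem M N).flip.obj t) (n := a) (fun σ => f σ ⊗ₜ[A] y) α s =
      f.altEvalAt α s ⊗ₜ[A] y := by
  classical
  by_cases hα : Function.Injective α
  · rw [SysCochain.altEvalAt_of_injective _ hα, SysCochain.altEvalAt_of_injective _ hα, ext0At_tmul_const,
      smul_tmul']
  · rw [SysCochain.altEvalAt_of_not_injective _ hα, SysCochain.altEvalAt_of_not_injective _ hα, zero_tmul]

/-! ## §2 The `κ`-direction and the double evaluation of `E(f ⊗ g)` -/

variable [Fintype ι] [Fintype κ]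

variable {M N} in
/-- **`κ`-direction**: the signed evaluation of `E(f ⊗ g) ∈ Čᵃᵇ(M ⊠ N)` (★ `tensorCochainEquiv`) at a `κ`-word `β`, read in
`Čᵃ((M ⊠ N)(·, t))`, is the cochain `σ ↦ f σ ⊗ g.altEvalAt β t` (the sign moves onto the second factor).
[cite: StacksProject, Tag 01FG] [cite: EilenbergMacLane1953, §5] -/
theorem altEvalAt_tensorCochainEquiv_tmul {a b : ℤ} (f : SysCochain M a) (g : SysCochain N b) {q : ℕ} (β : Fin q → κ)
    (t : Finset κ) (σ : Simplex ι a) :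
    ((tensorCochainEquiv M N a b (f ⊗ₜ g)).altEvalAt β t : SysCochain ((prodSystem M N).flip.obj t) a) σ =
      f σ ⊗ₜ[A] g.altEvalAt β t := by
  classical
  by_cases hβ : Function.Injective β
  · rw [SysCochain.altEvalAt_of_injective _ hβ, SysCochain.altEvalAt_of_injective _ hβ, tmul_smul]
    change (-1 : A) ^ inv β • (((tensorCochainEquiv M N a b (f ⊗ₜ g)).ext0At (Finset.univ.image β) t :
      SysCochain ((prodSystem M N).flip.obj t) a) σ) = _
    rw [ext0At_tensorCochainEquiv]
  · rw [SysCochain.altEvalAt_of_not_injective _ hβ, SysCochain.altEvalAt_of_not_injective _ hβ, tmul_zero]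
    rfl

variable {M N} in
/-- **The double alternating evaluation of a pure tensor**: `E(f ⊗ g)` read at the pair of words `(α, β)` in `M s ⊗ N t` is
`f.altEvalAt α s ⊗ g.altEvalAt β t`. [cite: EilenbergMacLane1953, §5] [cite: StacksProject, Tag 01FG] -/
theorem crossRead_tensorCochainEquiv_tmul {a b : ℤ} (f : SysCochain M a) (g : SysCochain N b) {p q : ℕ} (α : Fin p → ι)
    (β : Fin q → κ) (s : Finset ι) (t : Finset κ) :
    (tensorCochainEquiv M N a b (f ⊗ₜ g)).crossRead α β s t = f.altEvalAt α s ⊗ₜ[A] g.altEvalAt β t := by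
  unfold SysCochain.crossRead
  have hfun : ((tensorCochainEquiv M N a b (f ⊗ₜ g)).altEvalAt β t : SysCochain ((prodSystem M N).flip.obj t) a) =
      fun σ => f σ ⊗ₜ[A] g.altEvalAt β t :=
    funext fun σ => altEvalAt_tensorCochainEquiv_tmul f g β t σ
  rw [hfun, altEvalAt_tmul_const]

/-! ## §3 The read-out of the cross product on a pure tensor -/

variable {M N} in
/-- **`crossValue` of a pure tensor** (in range `a + b = n`): `f` at the `π₁`-word of the front `a`-face tensor `g` at the `π₂`-word
of the back `b`-face, in `M (π₁ T) ⊗ N (π₂ T)`. [cite: EilenbergMacLane1953, §5] [cite: StacksProject, Tag 0BEC] -/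
theorem crossValue_tensorCochainEquiv_tmul {a b n : ℤ} (h : 0 ≤ a ∧ 0 ≤ b ∧ a + b = n) (f : SysCochain M a)
    (g : SysCochain N b) (T : Simplex (ι ×ₗ κ) n) :
    crossValue (prodSystem M N) h (tensorCochainEquiv M N a b (f ⊗ₜ g)) T =
      f.altEvalAt (frontWord T.1 (crossCard h T)) (fstProj T.1) ⊗ₜ[A] g.altEvalAt (backWord T.1 (crossCard h T)) (sndProj T.1) :=
  crossRead_tensorCochainEquiv_tmul f g _ _ _ _

variable {M N} in
/-- **THE READ-OUT: the Alexander–Whitney cross product of a pure tensor** `f ⊗ g ∈ Čᵃ(M) ⊗ Čᵇ(N)`, `a + b = n`, at a chain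
`T = {w₀ < ⋯ < w_n}` of `ι ×ₗ κ` is `f(π₁ w₀, …, π₁ w_a) ⊗ g(π₂ w_a, …, π₂ w_n)` (signed evaluations; `0` if a letter repeats) in
`M (π₁ T) ⊗ N (π₂ T) = (lexSystem (M ⊠ N)) T`. [cite: EilenbergMacLane1953, §5] [cite: StacksProject, Tag 0BEC] -/
theorem crossComponent_tensorCochainEquiv_tmul {a b n : ℤ} (h : 0 ≤ a ∧ 0 ≤ b ∧ a + b = n) (f : SysCochain M a)
    (g : SysCochain N b) (T : Simplex (ι ×ₗ κ) n) :
    crossComponent (prodSystem M N) a b n (tensorCochainEquiv M N a b (f ⊗ₜ g)) T =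
      f.altEvalAt (frontWord T.1 (crossCard h T)) (fstProj T.1) ⊗ₜ[A] g.altEvalAt (backWord T.1 (crossCard h T)) (sndProj T.1) := by
  rw [crossComponent_apply_of _ h]
  exact crossValue_tensorCochainEquiv_tmul h f g T

end OrderedCech

end Literature.Algebra.Homology

end
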